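import Literature.MathematicalPhysics.QuantumFieldTheory.Balaban1983to89.B5QGQ171Unit
import Summits.QuantumFields.BalabanUV.T4Continuum.Spine.CoerciveInverseTower

/-!
# T⁴ programme, spine node NE2 (U1a) — coercivity of Bałaban's averaged propagator at `U = 1`, part 1: THE FIBRE BOUND
# `Re⟨y, Δ_a(p′) y⟩ ≤ (dπ² + a)·|y|²` for fibre vectors `y` supported on the central alias `l = 0` ((1.69)/(1.73))

Eighth generation of the NE2 prover lineage P1 of the cell `pub-balaban`, file 12a (companion 12b = `Support/BalabanAveragedCoercive`,
which proves the uniform coercivity `⟨B, n^dQ_k𝒢Q_kᴴB⟩ ≥ γ(d,a)‖B‖²` from this bound; split for the 400-line cap).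

 * §1 helpers: `x^*(Pᴴz) = (Px)^*z`, `Re⟨y, CCᴴy⟩ ≥ 0`, reindexing a dot product along an equivalence;
 * §2 for `y = yC c` (components `c : Fin d → ℂ` placed on the offset `l = 0`): **`re_form_DaBlocks_yC_le`**
   `Re⟨y, DaBlocks q y⟩ ≤ (dπ² + a)·Σ|c|²` at EVERY coarse momentum `q` (b05's fibres `B5Prop11Inverse.DaBlocks` of (1.73):
   at `p′ ≠ 0`, `Δ_a = Δ − ∂P∂* + aQ*Q` (`B5Prop11Inverse.Da`) with `∂P∂* = (∂P)(∂P)ᴴ ⪰ 0` (`Pproj` Hermitian idempotent,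
   `B5Prop11Lower.Pproj_isHermitian/Pproj_mul_Pproj`), `Δ(p′) = Σ_ν S_ξ(p′_ν) ≤ Σ_ν p′_ν² ≤ dπ²` (`B4Strip.Sxir_le`, `|p′_ν| ≤ π`),
   `|Q y|² ≤ |c|²` (`|u|, |v_μ| ≤ 1`); at `p′ = 0`, `Δ(0) = 0` and `Q*Q` = the projection onto the constants (`Da₀`, `Qv₀H_mul_Qv₀`)).

HONEST FRAMING (T4-DAG p. 1).  `U = 1`, finite torus, linear layer; statements and constants OURS ([folklore]); nothing printed
is a hypothesis.  NOT `U ≠ 1`, NOT infinite volume, NOT a mass gap, NOT Clay, NOT summit progress.  HONEST DEPENDENCY: continuum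
YM on T⁴ ⇐ BetaPertH ∧ nine spine estimates (0/9 proved); BetaPertH ⇐ (D1) ∧ (D4) ∧ CAP+tail; G-an2-4 gates asym, D1 and
NE2/3/4.  ABSOLUTE RULE kept; no `sorry`.
-/

noncomputable section

open scoped BigOperators ComplexConjugate Matrix ComplexOrder Matrix.Norms.L2Operator
open Finset Complex

namespace Summit.QuantumFields.BalabanUV.T4Continuum.BalabanAveragedCoerciveFibre

open Literature.MathematicalPhysics.QuantumFieldTheory.Balaban1983to89.B4Strip
open Literature.MathematicalPhysics.QuantumFieldTheory.Balaban1983to89.B5Prop11Leaves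
open Literature.MathematicalPhysics.QuantumFieldTheory.Balaban1983to89.B5Prop11Bound
open Literature.MathematicalPhysics.QuantumFieldTheory.Balaban1983to89.B5Prop11Fiber
open Literature.MathematicalPhysics.QuantumFieldTheory.Balaban1983to89.B5Prop11Plancherel
open Literature.MathematicalPhysics.QuantumFieldTheory.Balaban1983to89.B5Prop11Inverse
open Literature.MathematicalPhysics.QuantumFieldTheory.Balaban1983to89.B5Prop11Lower
open Literature.MathematicalPhysics.QuantumFieldTheory.Balaban1983to89.B5Block118
open Literature.MathematicalPhysics.QuantumFieldTheory.Balaban1983to89.B5QGQ171Unit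
open Summit.QuantumFields.BalabanUV.T4Continuum.CoerciveInverseTower (Coercive)

variable {d : ℕ}

/-! ## §1 Linear-algebra helpers -/

section Helpers

variable {m k : Type*} [Fintype m] [Fintype k]

/-- `x^*(Pᴴ z) = (P x)^* z`. [folklore] -/
theorem star_dotProduct_conjTranspose_mulVec (P : Matrix m k ℂ) (x : k → ℂ) (z : m → ℂ) :
    star x ⬝ᵥ (Pᴴ *ᵥ z) = star (P *ᵥ x) ⬝ᵥ z := by
  rw [Matrix.dotProduct_mulVec, Matrix.vecMul_conjTranspose, star_star]

/-- the real part of a quadratic form of a matrix of the shape `C Cᴴ` is nonnegative. [folklore] -/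
theorem re_form_mul_conjTranspose_nonneg [DecidableEq m] (C : Matrix m k ℂ) (y : m → ℂ) :
    0 ≤ (star y ⬝ᵥ ((C * Cᴴ) *ᵥ y)).re := by
  rw [← Matrix.mulVec_mulVec, Matrix.dotProduct_mulVec, ← Matrix.conjTranspose_conjTranspose C,
    Matrix.vecMul_conjTranspose, Matrix.conjTranspose_conjTranspose, star_star, star_dotProduct_self]
  exact_mod_cast nsq_nonneg _

omit [Fintype k] in
/-- reindexing both factors of a dot product along an equivalence. [folklore] -/
theorem dotProduct_comp_equiv {α : Type*} [Fintype α] (e : α ≃ m) (u w : m → ℂ) : (u ∘ ⇑e) ⬝ᵥ (w ∘ ⇑e) = u ⬝ᵥ w := by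
  simp only [dotProduct, Function.comp]
  exact e.sum_comp (fun j => u j * w j)

end Helpers

/-! ## §2 The fibre bound on the central alias: `Re⟨y, Δ_a(p′) y⟩ ≤ (dπ² + a)|y|²` for `y` supported on `l = 0` -/

section FibreBound

variable (n : ℕ) [NeZero n] (hn : 1 ≤ n) (M : Fin d → ℕ) [hM : ∀ μ, NeZero (M μ)] (a : ℝ) (ha : 0 < a)

/-- the zero offset `l = 0`. [folklore] -/
abbrev k0 : Fin d → Fin n := fun _ => 0

/-- a fibre vector supported on the central alias `l = 0` with components `c`. [folklore] -/
def yC (c : Fin d → ℂ) : (Fin d → Fin n) × Fin d → ℂ := fun i => if i.1 = k0 n then c i.2 else 0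

omit hM in
/-- `Σ|yC c|² = Σ|c|²`. [folklore] -/
theorem nsq_yC (c : Fin d → ℂ) : nsq (yC n c) = nsq c := by
  unfold nsq yC
  rw [Fintype.sum_prod_type, Finset.sum_eq_single (k0 n)]
  · simp
  · intro k _ hk
    simp [hk]
  · intro h; exact absurd (Finset.mem_univ _) h

/-- `Δ(p′) ≤ dπ²` at the central alias: `Σ_ν |∂_ν(p′)|² = Σ_ν S_ξ(p′_ν) ≤ Σ_ν p′_ν² ≤ dπ²`. [cite: Balaban1984PropagatorsI,
(1.31) p.23] [folklore] -/
theorem Delta_centre_le (q : Tor M) : DeltaXir n 0 (shiftr n (k0 n) (sOf M q)) ≤ d * Real.pi ^ 2 := by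
  unfold DeltaXir
  rw [add_zero]
  calc ∑ μ, Sxir n (shiftr n (k0 n) (sOf M q) μ) ≤ ∑ _μ : Fin d, Real.pi ^ 2 := by
        refine Finset.sum_le_sum fun μ _ => ?_
        have hsh : shiftr n (k0 n) (sOf M q) μ = sOf M q μ := by simp [shiftr, k0]
        rw [hsh]
        refine (Sxir_le n _).trans ?_
        have h := abs_sOf_le M q μ
        rw [← sq_abs]
        exact pow_le_pow_left₀ (abs_nonneg _) h 2
    _ = d * Real.pi ^ 2 := by rw [Finset.sum_const, Finset.card_univ, Fintype.card_fin, nsmul_eq_mul]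

/-- the fibre bound at `p′ ≠ 0`: `Re⟨y, Δ_a(p′) y⟩ ≤ (dπ² + a)|c|²` for `y = yC c`. [cite: Balaban1984PropagatorsI, (1.69) p.29,
(1.73) p.30] [folklore] -/
theorem re_form_Da_yC_le {q : Tor M} (hq : q ≠ 0) (c : Fin d → ℂ) :
    (star (yC n c) ⬝ᵥ (Da (balabanFiber n hn a ha (sOf M q) (abs_sOf_le M q) (sOf_ne_zero M hq)) *ᵥ yC n c)).re
      ≤ (d * Real.pi ^ 2 + a) * nsq c := by
  set F := balabanFiber n hn a ha (sOf M q) (abs_sOf_le M q) (sOf_ne_zero M hq) with hF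
  -- split `Δ_a = Δ − ∂P∂* + aQ*Q`
  have hsplit : star (yC n c) ⬝ᵥ (Da F *ᵥ yC n c)
      = star (yC n c) ⬝ᵥ (lapV F *ᵥ yC n c) - star (yC n c) ⬝ᵥ ((dOp F * Pproj F * (dOp F)ᴴ) *ᵥ yC n c)
        + (F.a : ℂ) * (star (yC n c) ⬝ᵥ (((Qv F)ᴴ * Qv F) *ᵥ yC n c)) := by
    rw [Da, Matrix.add_mulVec, Matrix.sub_mulVec, dotProduct_add, dotProduct_sub, Matrix.smul_mulVec, dotProduct_smul,
      smul_eq_mul]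
  -- (a) the Laplacian part: `Σ_μ Δ(0)|c_μ|² ≤ dπ²|c|²`
  have hlap : (star (yC n c) ⬝ᵥ (lapV F *ᵥ yC n c)).re ≤ d * Real.pi ^ 2 * nsq c := by
    have e : star (yC n c) ⬝ᵥ (lapV F *ᵥ yC n c) = (((DeltaXir n 0 (shiftr n (k0 n) (sOf M q)) * nsq c : ℝ)) : ℂ) := by
      rw [lapV]
      simp only [dotProduct, Matrix.mulVec_diagonal, Pi.star_apply, yC]
      rw [Fintype.sum_prod_type, Finset.sum_eq_single (k0 n)]
      · simp only [if_true]
        unfold nsq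
        push_cast
        rw [Finset.mul_sum]
        refine Finset.sum_congr rfl fun μ _ => ?_
        have : (F.Δ (k0 n) : ℂ) = ((DeltaXir n 0 (shiftr n (k0 n) (sOf M q)) : ℝ) : ℂ) := rfl
        rw [this, Complex.star_def, mul_left_comm, ← Complex.normSq_eq_conj_mul_self, Complex.normSq_eq_norm_sq]
        push_cast; ring
      · intro k _ hk; simp [hk]
      · intro h; exact absurd (Finset.mem_univ _) h
    rw [e, Complex.ofReal_re]
    exact mul_le_mul_of_nonneg_right (Delta_centre_le n M q) (nsq_nonneg c)
  -- (b) the gauge part is nonnegative: `∂P∂* = (∂P)(∂P)*`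
  have hgauge : 0 ≤ (star (yC n c) ⬝ᵥ ((dOp F * Pproj F * (dOp F)ᴴ) *ᵥ yC n c)).re := by
    have e : dOp F * Pproj F * (dOp F)ᴴ = (dOp F * Pproj F) * (dOp F * Pproj F)ᴴ := by
      rw [Matrix.conjTranspose_mul, (Pproj_isHermitian F).eq]
      symm
      rw [← Matrix.mul_assoc, Matrix.mul_assoc (dOp F) (Pproj F) (Pproj F), Pproj_mul_Pproj]
    rw [e]
    exact re_form_mul_conjTranspose_nonneg _ _
  -- (c) the averaging part: `|Qv y|² ≤ |c|²`
  have havg : (star (yC n c) ⬝ᵥ (((Qv F)ᴴ * Qv F) *ᵥ yC n c)).re ≤ nsq c := by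
    rw [← Matrix.mulVec_mulVec, star_dotProduct_conjTranspose_mulVec, star_dotProduct_self, Complex.ofReal_re]
    -- `(Qv y)_μ = u(0) v_μ(0) c_μ`
    have hQ : ∀ μ, (Qv F *ᵥ yC n c) μ = F.u (k0 n) * F.v μ (k0 n) * c μ := by
      intro μ
      simp only [Matrix.mulVec, dotProduct, Qv, yC]
      rw [Fintype.sum_prod_type, Finset.sum_eq_single (k0 n)]
      · rw [Finset.sum_eq_single μ]
        · simp
        · intro ν _ hν; simp [hν]
        · intro h; exact absurd (Finset.mem_univ _) h
      · intro k _ hk; simp [hk]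
      · intro h; exact absurd (Finset.mem_univ _) h
    unfold nsq
    refine Finset.sum_le_sum fun μ _ => ?_
    rw [hQ, norm_mul, norm_mul]
    have hu : ‖F.u (k0 n)‖ ≤ 1 := F.norm_u_le _
    have hv : ‖F.v μ (k0 n)‖ ≤ 1 := F.norm_v_le μ _
    have h1 : ‖F.u (k0 n)‖ * ‖F.v μ (k0 n)‖ * ‖c μ‖ ≤ 1 * 1 * ‖c μ‖ :=
      mul_le_mul (mul_le_mul hu hv (norm_nonneg _) zero_le_one) le_rfl (norm_nonneg _) (by positivity)
    calc (‖F.u (k0 n)‖ * ‖F.v μ (k0 n)‖ * ‖c μ‖) ^ 2 ≤ (1 * 1 * ‖c μ‖) ^ 2 :=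
          pow_le_pow_left₀ (by positivity) h1 2
      _ = ‖c μ‖ ^ 2 := by ring
  have haF : (F.a : ℂ) = (a : ℂ) := rfl
  rw [hsplit, haF, Complex.add_re, Complex.sub_re, Complex.re_ofReal_mul]
  nlinarith [hlap, hgauge, havg, mul_le_mul_of_nonneg_left havg ha.le]

/-- the fibre bound at `p′ = 0`: `Re⟨y, Δ_a(0) y⟩ = a|c|²` for `y = yC c` (`Δ(0) = 0`, `Q*Q` = projection onto the constants).
[cite: Balaban1984PropagatorsI, (1.73)-(1.74) p.30] [folklore] -/
theorem re_form_Da₀_yC_le (c : Fin d → ℂ) :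
    (star (yC n c) ⬝ᵥ (DaBlocks n hn M a ha 0 *ᵥ yC n c)).re ≤ (d * Real.pi ^ 2 + a) * nsq c := by
  have hΔ0 : DeltaXir n 0 (shiftr n (k0 n) (0 : Fin d → ℝ)) = 0 := by
    unfold DeltaXir
    rw [add_zero]
    refine Finset.sum_eq_zero fun μ _ => ?_
    simp [shiftr, k0, Sxir]
  have e : star (yC n c) ⬝ᵥ (DaBlocks n hn M a ha 0 *ᵥ yC n c) = (((a * nsq c : ℝ)) : ℂ) := by
    simp only [DaBlocks, dif_pos]
    rw [Da₀, Qv₀H_mul_Qv₀, Matrix.add_mulVec, dotProduct_add, Matrix.smul_mulVec, dotProduct_smul, smul_eq_mul]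
    have h1 : star (yC n c) ⬝ᵥ ((Matrix.diagonal fun i : (Fin d → Fin n) × Fin d => ((DeltaXir n 0 (shiftr n i.1 0) : ℝ) : ℂ))
        *ᵥ yC n c) = 0 := by
      simp only [dotProduct, Matrix.mulVec_diagonal, Pi.star_apply, yC]
      refine Finset.sum_eq_zero fun i _ => ?_
      by_cases hi : i.1 = k0 n
      · rw [hi, hΔ0]; simp
      · simp [hi]
    have h2 : star (yC n c) ⬝ᵥ ((Matrix.diagonal fun i : (Fin d → Fin n) × Fin d =>
        if i.1 = (fun _ => (0 : Fin n)) then (1 : ℂ) else 0) *ᵥ yC n c) = ((nsq c : ℝ) : ℂ) := by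
      simp only [dotProduct, Matrix.mulVec_diagonal, Pi.star_apply, yC]
      rw [Fintype.sum_prod_type, Finset.sum_eq_single (k0 n)]
      · simp only [if_true, one_mul]
        unfold nsq
        push_cast
        refine Finset.sum_congr rfl fun μ _ => ?_
        rw [Complex.star_def, ← Complex.normSq_eq_conj_mul_self, Complex.normSq_eq_norm_sq]
        push_cast; ring
      · intro k _ hk
        have hk' : ¬ (k = fun _ => (0 : Fin n)) := hk
        simp [hk']
      · intro h; exact absurd (Finset.mem_univ _) h
    rw [h1, h2, zero_add]
    push_cast; ring
  rw [e, Complex.ofReal_re]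
  have h0 : 0 ≤ (d : ℝ) * Real.pi ^ 2 * nsq c := mul_nonneg (mul_nonneg (Nat.cast_nonneg d) (sq_nonneg _)) (nsq_nonneg c)
  nlinarith [h0]

/-- both cases: `Re⟨yC c, DaBlocks q (yC c)⟩ ≤ (dπ² + a)·|c|²`. [folklore] -/
theorem re_form_DaBlocks_yC_le (q : Tor M) (c : Fin d → ℂ) :
    (star (yC n c) ⬝ᵥ (DaBlocks n hn M a ha q *ᵥ yC n c)).re ≤ (d * Real.pi ^ 2 + a) * nsq c := by
  by_cases hq : q = 0
  · subst hq; exact re_form_Da₀_yC_le n hn M a ha c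
  · simp only [DaBlocks, dif_neg hq]
    exact re_form_Da_yC_le n hn M a ha hq c

end FibreBound

end Summit.QuantumFields.BalabanUV.T4Continuum.BalabanAveragedCoerciveFibre

end
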